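import Mathlib.AlgebraicGeometry.AlgClosed.Basic
import Mathlib.Analysis.Complex.Polynomial.Basic
import Mathlib.AlgebraicGeometry.Noetherian
import Mathlib.RingTheory.DualNumber
import Mathlib.RingTheory.Nakayama
import Mathlib.LinearAlgebra.Dual.Lemmas
import Literature.RingTheory.CompleteLocalRings.DualNumberPoints
import Literature.AlgebraicGeometry.Motives.Varieties
import HarnessLib

/-!
# No non-constant `ℂ[ε]`-points in the fibres ⇒ the stalk conditions for unramifiedness
# (Görtz–Wedhorn I (6.4), Prop. 6.7: tangent vectors as `k[ε]`-points; Nakayama)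

Topic `Literature/AlgebraicGeometry/Morphisms`, namespace `Literature.AlgebraicGeometry.Morphisms`.  THEOREMS ONLY
(no definition, no named fact, no `sorry`).  Generic, consumer-agnostic leaf; in the cell `hodgecm-mathlib` it is the
node «(4M-i)» of the road «the seesaw graph is étale over the base» towards the universal property of the normalised
Poincaré sheaf (Mumford, *Abelian Varieties*, §13), where it feeds
★ `Literature.AlgebraicGeometry.Morphisms.formallyUnramified_of_forall_isClosed_map_maximalIdeal`.

**Statement** (`stalk_of_dualNumber_rigid`).  Let `p : Γ ⟶ T` be a morphism of `ℂ`-schemes with `T` and `p` locally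
of finite type, and suppose that every `ℂ[ε]`-point `γ` of `Γ` lying over a CONSTANT `ℂ[ε]`-point of `T`
(`γ ≫ p = toUnit _ ≫ t`) is itself constant (`γ = toUnit _ ≫ γ₀`).  Then at every closed point `x` of `Γ`:
`κ(p x) → κ(x)` is onto and `𝔪_{p x} 𝒪_{Γ,x} = 𝔪_x` — the two hypotheses of
`formallyUnramified_of_forall_isClosed_map_maximalIdeal`, so that `p` is unramified.

**Proof.**  Residue fields of closed points of schemes locally of finite type over `ℂ` are `ℂ` (Mathlib
`residueFieldIsoBase`), whence the first clause.  For the second (`map_maximalIdeal_eq_of_tangent_rigid`, pure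
commutative algebra): `B := 𝒪_{Γ,x}` is an augmented local `ℂ`-algebra (`ℂ → B → κ(x) = ℂ`) with `𝔪_B` finitely
generated; by ★ `Literature.RingTheory.CompleteLocalRings.TangentHom.ofDual` every `ℂ`-linear form `ℓ` on
`𝔪_B/𝔪_B²` is the `ε`-part of a `ℂ`-algebra map `g_ℓ : B → ℂ[ε]`, `b ↦ b̄ + ℓ[b − b̄] ε`, i.e. of a `ℂ[ε]`-point
`Spec ℂ[ε] → Spec 𝒪_{Γ,x} → Γ` through `x`; if `ℓ` kills the image of `𝔪_A`, `A := 𝒪_{T, p x}`, then `g_ℓ ∘ p^♯`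
is constant (`A = ℂ + 𝔪_A` as `p x` is closed), so by hypothesis `g_ℓ` is constant and `ℓ = 0`.  Hence the image
of `𝔪_A` spans `𝔪_B/𝔪_B²`, `𝔪_B ⊆ 𝔪_A B + 𝔪_B²`, and Nakayama gives `𝔪_B = 𝔪_A B`.

§1 is the dictionary «points with values in a local ring `R` through `x` ↔ local homomorphisms `𝒪_{X,x} → R`»
(Mathlib `Scheme.stalkClosedPointTo`, `Scheme.fromSpecStalk`; the tree's `Motives/AbelianVarietyPointDerivations`
§1 has it for abelian varieties, here for an arbitrary scheme); §2 the structure map `K → 𝒪_{X,x}` of a `K`-scheme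
and the augmentation at a closed point; §3 the core lemma; §4 the statement.  The `ℂ[ε]`-points are morphisms
from the tree's `specOver ℂ ℂ[ε]` in `SchemeOver ℂ = Over (Spec ℂ)`.

## References
* U. Görtz, T. Wedhorn, *Algebraic Geometry I* (2nd ed. 2020), (6.4) and Prop. 6.7 (tangent space as
  `k[ε]`-valued points), Exercise 3.18, Cor. 3.36. [GortzWedhorn2020]
* B. Mazur, *An introduction to the deformation theory of Galois representations* (1997), §15. [Mazur1997Deformation]
* The Stacks Project, Tag 02FM (unramified at a point via `𝔪_y 𝒪_x = 𝔪_x`), Tag 00DV (Nakayama). [StacksProject]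
* D. Mumford, *Abelian Varieties* (1970), §13 (proof of the theorem, pp. 125–130). [MumfordAV1970]
-/

set_option autoImplicit false

noncomputable section

universe u

open CategoryTheory CategoryTheory.Limits AlgebraicGeometry TopologicalSpace IsLocalRing

namespace Literature.AlgebraicGeometry.Morphisms

/-! ### §1 Points with values in a local ring through a given point of a scheme
(adapted from `Literature/AlgebraicGeometry/Motives/AbelianVarietyPointDerivations` §1, which is typed
for abelian varieties; here for an arbitrary scheme) -/

section PointsAt

variable {X : Scheme.{u}} {R : CommRingCat.{u}} [IsLocalRing R] {x : X}

/-- `Spec R → Spec 𝒪_{X,x} → X` maps the closed point to `x` when `g : 𝒪_{X,x} → R` is local (the point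
of `X` with values in the local ring `R` defined by `g`; inverse direction of Mathlib
`Scheme.SpecToEquivOfLocalRing`).
-- adapted from Literature/AlgebraicGeometry/Motives/AbelianVarietyPointDerivations (`ptOfStalkHomAt`)
[cite: GortzWedhorn2020, Exercise 3.18 and (6.4) Prop. 6.7] -/
theorem specPtAt_closedPoint (g : X.presheaf.stalk x ⟶ R) [IsLocalHom g.hom] :
    (Spec.map g ≫ X.fromSpecStalk x).base (closedPoint R) = x := by
  rw [Scheme.Hom.comp_apply, Spec_closedPoint, Scheme.fromSpecStalk_closedPoint]

/-- The local homomorphism `𝒪_{X,x} → R` of a morphism `t : Spec R → X` mapping the closed point to `x`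
(Mathlib `Scheme.stalkClosedPointTo`, transported along `t(𝔪_R) = x`) is a local homomorphism.
-- adapted from Literature/AlgebraicGeometry/Motives/AbelianVarietyPointDerivations (`evAtPt`)
[cite: GortzWedhorn2020, Exercise 3.18 and (6.4) Prop. 6.7] -/
theorem isLocalHom_locHomAt (t : Spec R ⟶ X) (ht : t.base (closedPoint R) = x) :
    IsLocalHom ((X.presheaf.stalkCongr (.of_eq ht)).inv ≫ Scheme.stalkClosedPointTo t).hom := by
  rw [CommRingCat.hom_comp]
  haveI := isLocalHom_of_isIso (X.presheaf.stalkCongr (.of_eq ht)).inv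
  infer_instance

/-- The transported local homomorphism is compatible with equalities of points.
[cite: GortzWedhorn2020, Exercise 3.18 and (6.4) Prop. 6.7] -/
theorem locHomAt_congr {t t' : Spec R ⟶ X} (h : t = t') (ht : t.base (closedPoint R) = x)
    (ht' : t'.base (closedPoint R) = x) :
    (X.presheaf.stalkCongr (.of_eq ht)).inv ≫ Scheme.stalkClosedPointTo t =
      (X.presheaf.stalkCongr (.of_eq ht')).inv ≫ Scheme.stalkClosedPointTo t' := by
  subst h; rfl

/-- The local homomorphism of `Spec R → Spec 𝒪_{X,x} → X` is `g`.
[cite: GortzWedhorn2020, Exercise 3.18 and (6.4) Prop. 6.7] -/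
theorem locHomAt_specPtAt (g : X.presheaf.stalk x ⟶ R) [IsLocalHom g.hom]
    (h : (Spec.map g ≫ X.fromSpecStalk x).base (closedPoint R) = x) :
    (X.presheaf.stalkCongr (.of_eq h)).inv ≫ Scheme.stalkClosedPointTo (Spec.map g ≫ X.fromSpecStalk x) =
      g := by
  apply TopCat.Presheaf.stalk_hom_ext
  intro U hU
  rw [TopCat.Presheaf.stalkCongr_inv, TopCat.Presheaf.germ_stalkSpecializes_assoc,
    Scheme.germ_stalkClosedPointTo_Spec_fromSpecStalk]

/-- A point with values in a local ring is `Spec` of its local homomorphism followed by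
`Spec 𝒪_{X,x} → X` (Mathlib `Scheme.Spec_stalkClosedPointTo_fromSpecStalk`, transported).
[cite: GortzWedhorn2020, Exercise 3.18 and (6.4) Prop. 6.7] -/
theorem specPtAt_locHomAt (t : Spec R ⟶ X) (ht : t.base (closedPoint R) = x) :
    Spec.map ((X.presheaf.stalkCongr (.of_eq ht)).inv ≫ Scheme.stalkClosedPointTo t) ≫
      X.fromSpecStalk x = t := by
  rw [Spec.map_comp, Category.assoc, TopCat.Presheaf.stalkCongr_inv,
    Scheme.SpecMap_stalkSpecializes_fromSpecStalk, Scheme.Spec_stalkClosedPointTo_fromSpecStalk]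

/-- Functoriality in `R`: the local homomorphism of `Spec S → Spec R → X` is `ψ ∘` (that of
`Spec R → X`). [cite: GortzWedhorn2020, Exercise 3.18 and (6.4) Prop. 6.7] -/
theorem locHomAt_SpecMap_comp {S : CommRingCat.{u}} [IsLocalRing S] (ψ : R ⟶ S) [IsLocalHom ψ.hom]
    (t : Spec R ⟶ X) (ht : t.base (closedPoint R) = x)
    (ht' : (Spec.map ψ ≫ t).base (closedPoint S) = x) :
    (X.presheaf.stalkCongr (.of_eq ht')).inv ≫ Scheme.stalkClosedPointTo (Spec.map ψ ≫ t) =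
      ((X.presheaf.stalkCongr (.of_eq ht)).inv ≫ Scheme.stalkClosedPointTo t) ≫ ψ := by
  have key : Spec.map ψ ≫ t =
      Spec.map (((X.presheaf.stalkCongr (.of_eq ht)).inv ≫ Scheme.stalkClosedPointTo t) ≫ ψ) ≫
        X.fromSpecStalk x := by
    conv_lhs => rw [← specPtAt_locHomAt t ht]
    rw [Spec.map_comp _ ψ, Category.assoc]
  haveI := isLocalHom_locHomAt t ht
  haveI : IsLocalHom (((X.presheaf.stalkCongr (.of_eq ht)).inv ≫ Scheme.stalkClosedPointTo t) ≫ ψ).hom := by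
    rw [CommRingCat.hom_comp]; infer_instance
  rw [locHomAt_congr key ht' (key ▸ ht'), locHomAt_specPtAt _ (key ▸ ht')]

end PointsAt

/-! ### §2 The structure map `K → 𝒪_{X,x}` of a `K`-scheme and the augmentation at a closed point -/

section Structure

variable {K : Type u} [Field K] {X Y : Scheme.{u}}

/-- The structure map `K = Γ(Spec K) → 𝒪_{Spec K, F x} → 𝒪_{X,x}` of a `K`-scheme `F : X → Spec K` at a
point `x` has `Spec (K → 𝒪_{X,x}) = (Spec 𝒪_{X,x} → X → Spec K)`. [cite: GortzWedhorn2020, (3.4) and Exercise 3.18] -/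
theorem Spec_map_strMap (F : X ⟶ Spec (.of K)) (x : X) :
    Spec.map (((Scheme.ΓSpecIso (.of K)).inv ≫ (Spec (.of K)).presheaf.germ ⊤ (F.base x) trivial) ≫
      F.stalkMap x) = X.fromSpecStalk x ≫ F := by
  rw [Spec.map_comp, ← Spec.fromSpecStalk_eq, Scheme.SpecMap_stalkMap_fromSpecStalk]

/-- The structure maps along a `K`-morphism: `K → 𝒪_{Y, g x} → 𝒪_{X,x}` is `K → 𝒪_{X,x}`.
[cite: GortzWedhorn2020, (3.4) and Exercise 3.18] -/
theorem strMap_comp (g : X ⟶ Y) (G : Y ⟶ Spec (.of K)) (x : X) :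
    ((Scheme.ΓSpecIso (.of K)).inv ≫ (Spec (.of K)).presheaf.germ ⊤ ((g ≫ G).base x) trivial) ≫
        (g ≫ G).stalkMap x =
      (((Scheme.ΓSpecIso (.of K)).inv ≫ (Spec (.of K)).presheaf.germ ⊤ (G.base (g.base x)) trivial) ≫
        G.stalkMap (g.base x)) ≫ g.stalkMap x := by
  simp only [Scheme.Hom.stalkMap_comp, Category.assoc]
  rfl

variable [IsAlgClosed K] (F : X ⟶ Spec (.of K)) [LocallyOfFiniteType F] (x : X)
  (hx : IsClosed ({x} : Set X))

/-- At a closed point of a `K`-scheme locally of finite type (`K` algebraically closed), `K → 𝒪_{X,x} → κ(x)`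
is the inverse of Mathlib's `residueFieldIsoBase : κ(x) ≅ K` (Hilbert's Nullstellensatz); the AUGMENTATION
of `𝒪_{X,x}` is `𝒪_{X,x} → κ(x) ≅ K`. [cite: GortzWedhorn2020, Cor. 3.36 (closed points have residue field k)] -/
theorem strMap_comp_residue :
    (((Scheme.ΓSpecIso (.of K)).inv ≫ (Spec (.of K)).presheaf.germ ⊤ (F.base x) trivial) ≫ F.stalkMap x) ≫
      X.residue x = (residueFieldIsoBase F x hx).inv := by
  apply Spec.map_injective
  rw [Spec.map_comp, SpecMap_residueFieldIsoBase_inv, Spec_map_strMap, Scheme.fromSpecResidueField,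
    Category.assoc]

/-- `K → 𝒪_{X,x} → κ(x) ≅ K` is the identity. [cite: GortzWedhorn2020, Cor. 3.36] -/
theorem strMap_comp_augAt :
    (((Scheme.ΓSpecIso (.of K)).inv ≫ (Spec (.of K)).presheaf.germ ⊤ (F.base x) trivial) ≫ F.stalkMap x) ≫
      X.residue x ≫ (residueFieldIsoBase F x hx).hom = 𝟙 _ := by
  rw [← Category.assoc, strMap_comp_residue F x hx, Iso.inv_hom_id]

/-- Pointwise form of `strMap_comp_augAt`. [cite: GortzWedhorn2020, Cor. 3.36] -/
theorem augAt_strMap (c : K) :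
    (X.residue x ≫ (residueFieldIsoBase F x hx).hom)
      ((((Scheme.ΓSpecIso (.of K)).inv ≫ (Spec (.of K)).presheaf.germ ⊤ (F.base x) trivial) ≫
        F.stalkMap x) c) = c := by
  rw [← CommRingCat.comp_apply, strMap_comp_augAt, CommRingCat.id_apply]

/-- **`𝒪_{X,x} = K + 𝔪_x` at a closed point**: `a − (structure map of the augmentation of a)` lies in the
maximal ideal. [cite: GortzWedhorn2020, Cor. 3.36] -/
theorem sub_strMap_augAt_mem (a : X.presheaf.stalk x) :
    a - (((Scheme.ΓSpecIso (.of K)).inv ≫ (Spec (.of K)).presheaf.germ ⊤ (F.base x) trivial) ≫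
        F.stalkMap x) ((X.residue x ≫ (residueFieldIsoBase F x hx).hom) a) ∈
      maximalIdeal (X.presheaf.stalk x) := by
  rw [← residue_eq_zero_iff, map_sub, sub_eq_zero]
  change X.residue x a = ((((Scheme.ΓSpecIso (.of K)).inv ≫
      (Spec (.of K)).presheaf.germ ⊤ (F.base x) trivial) ≫ F.stalkMap x) ≫ X.residue x)
    ((X.residue x ≫ (residueFieldIsoBase F x hx).hom) a)
  rw [strMap_comp_residue F x hx, CommRingCat.comp_apply,
    ← CommRingCat.comp_apply (residueFieldIsoBase F x hx).hom, Iso.hom_inv_id, CommRingCat.id_apply]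

/-- The augmentation kills the maximal ideal. [cite: GortzWedhorn2020, Cor. 3.36] -/
theorem augAt_eq_zero_of_mem {a : X.presheaf.stalk x} (ha : a ∈ maximalIdeal (X.presheaf.stalk x)) :
    (X.residue x ≫ (residueFieldIsoBase F x hx).hom) a = 0 := by
  change (residueFieldIsoBase F x hx).hom (X.residue x a) = 0
  have : X.residue x a = 0 := (residue_eq_zero_iff _).2 ha
  rw [this, map_zero]

end Structure

/-! ### §3 The core lemma: tangent rigidity forces `𝔪_A B = 𝔪_B` (commutative algebra) -/

section Core

open TrivSqZeroExt Literature.RingTheory.CompleteLocalRings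

variable {k : Type u} [Field k] {A B : Type u} [CommRing A] [CommRing B] [IsLocalRing A]
  [IsLocalRing B] [Algebra k B] (π : B →ₐ[k] k) (φ : A →+* B) [IsLocalHom φ]

/-- **Core lemma (Görtz–Wedhorn I Prop. 6.7 + Nakayama).**  Let `φ : A → B` be a local homomorphism of
local rings, `B` an augmented `k`-algebra (`π : B → k`, so `𝔪_B = ker π`) with `𝔪_B` finitely generated.
If every tangent vector `g : B → k[ε]` of `(B, π)` whose `ε`-part kills `φ(𝔪_A)` has `ε`-part killing
`𝔪_B`, then `𝔪_A B = 𝔪_B`: a linear form on `𝔪_B/𝔪_B²` vanishing on the image of `𝔪_A` is the `ε`-part of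
such a `g` (★ `TangentHom.ofDual`), hence zero, so the image of `𝔪_A` spans `𝔪_B/𝔪_B²`, i.e.
`𝔪_B ⊆ 𝔪_A B + 𝔪_B²`, and Nakayama concludes.
[cite: GortzWedhorn2020, (6.4) Prop. 6.7] [cite: Mazur1997Deformation, §15] [cite: StacksProject, Tag 00DV] -/
theorem map_maximalIdeal_eq_of_tangent_rigid (hfg : (maximalIdeal B).FG)
    (H : ∀ g : TangentHom π, (∀ a ∈ maximalIdeal A, (g.1 (φ a)).snd = 0) →
      ∀ b ∈ maximalIdeal B, (g.1 b).snd = 0) :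
    (maximalIdeal A).map φ = maximalIdeal B := by
  apply le_antisymm (IsLocalRing.map_maximalIdeal_le φ)
  have hJ : (maximalIdeal A).map φ ≤ maximalIdeal B := IsLocalRing.map_maximalIdeal_le φ
  have hI : RingHom.ker π = maximalIdeal B := TangentHom.ker_eq_maximalIdeal π
  -- the elements of `I := ker π = 𝔪_B` lying in `J := 𝔪_A B`, and their classes in `I/I²`
  let JI : Submodule B ↥(RingHom.ker π) := Submodule.comap (RingHom.ker π).subtype ((maximalIdeal A).map φ)
  let S : Set (RingHom.ker π).Cotangent := (RingHom.ker π).toCotangent '' (JI : Set ↥(RingHom.ker π))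
  -- Step 1: `S` spans `I/I²` over `k`
  have hspan : Submodule.span k S = ⊤ := by
    by_contra hne
    obtain ⟨ℓ, hℓ0, hℓS⟩ :=
      Submodule.exists_dual_map_eq_bot_of_lt_top (lt_top_iff_ne_top.2 hne) inferInstance
    apply hℓ0
    have hℓJ : ∀ v : ↥(RingHom.ker π), (v : B) ∈ (maximalIdeal A).map φ →
        ℓ ((RingHom.ker π).toCotangent v) = 0 := fun v hv => by
      have hv' : ℓ ((RingHom.ker π).toCotangent v) ∈ Submodule.map ℓ (Submodule.span k S) :=
        Submodule.mem_map_of_mem (Submodule.subset_span ⟨v, hv, rfl⟩)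
      rwa [hℓS, Submodule.mem_bot] at hv'
    -- the tangent vector `g_ℓ` has `ε`-part killing `φ(𝔪_A)`, hence killing `𝔪_B`
    have hg := H (TangentHom.ofDual ℓ) (fun a ha => by
      have hφa : φ a ∈ RingHom.ker π := hI ▸ hJ (Ideal.mem_map_of_mem φ ha)
      have hproj : TangentHom.proj π (φ a) = ⟨φ a, hφa⟩ := TangentHom.proj_of_mem ⟨φ a, hφa⟩
      rw [TangentHom.ofDual_apply, snd_add, snd_inl, snd_inr, zero_add, hproj]
      exact hℓJ ⟨φ a, hφa⟩ (Ideal.mem_map_of_mem φ ha))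
    refine LinearMap.ext fun v => ?_
    obtain ⟨v, rfl⟩ := (RingHom.ker π).toCotangent_surjective v
    have hv := hg v (hI ▸ v.2)
    rw [TangentHom.ofDual_apply, snd_add, snd_inl, snd_inr, zero_add, TangentHom.proj_of_mem] at hv
    rw [hv, LinearMap.zero_apply]
  -- Step 2: `𝔪_B ⊆ 𝔪_A B + 𝔪_B²`
  have hsup : maximalIdeal B ≤ (maximalIdeal A).map φ ⊔ maximalIdeal B • maximalIdeal B := by
    intro b hb
    have hbI : b ∈ RingHom.ker π := hI ▸ hb
    have hmem : (RingHom.ker π).toCotangent ⟨b, hbI⟩ ∈ Submodule.span k S := by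
      rw [hspan]; exact Submodule.mem_top
    have hmem' : (RingHom.ker π).toCotangent ⟨b, hbI⟩ ∈ Submodule.span B S :=
      Submodule.span_le_restrictScalars k B S hmem
    rw [Submodule.span_image, Submodule.span_eq] at hmem'
    obtain ⟨w, hw, hwb⟩ := hmem'
    have hwJ : (w : B) ∈ (maximalIdeal A).map φ := hw
    have hsq : b - (w : B) ∈ RingHom.ker π ^ 2 :=
      (Ideal.toCotangent_eq_zero _ _).1
        (show (RingHom.ker π).toCotangent (⟨b, hbI⟩ - w) = 0 by rw [map_sub, hwb, sub_self])
    have hsq' : b - (w : B) ∈ maximalIdeal B • maximalIdeal B := by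
      rw [← hI, Ideal.smul_eq_mul, ← pow_two]; exact hsq
    have hbw : b = w + (b - w) := by ring
    rw [hbw]
    exact Submodule.add_mem_sup hwJ hsq'
  -- Step 3: Nakayama
  exact Submodule.le_of_le_smul_of_le_jacobson_bot hfg
    (IsLocalRing.jacobson_eq_maximalIdeal (⊥ : Ideal B) bot_ne_top).symm.le hsup

end Core

/-! ### §4 The scheme statement: `ℂ[ε]`-rigidity of the fibres gives the stalk conditions -/

section DualNumberRigid

open TrivSqZeroExt DualNumber MonoidalCategory CartesianMonoidalCategory
  Literature.RingTheory.CompleteLocalRings Literature.AlgebraicGeometry.Motives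

/-- The structure map `ℂ → ℂ[ε]` is a local homomorphism (a dual number is a unit iff its constant
part is). [cite: GortzWedhorn2020, (6.4)] -/
theorem isLocalHom_algebraMap_dualNumber : IsLocalHom (algebraMap ℂ ℂ[ε]) :=
  ⟨fun c hc => by rwa [isUnit_iff_isUnit_fst, algebraMap_eq_inl, fst_inl] at hc⟩

/-- **No non-constant `ℂ[ε]`-points in the fibres ⇒ the stalk conditions for unramifiedness.**
For `p : Γ ⟶ T` over `ℂ` with `T` and `p`
locally of finite type: if every `ℂ[ε]`-point `γ` of `Γ` with CONSTANT image `γ ≫ p = toUnit _ ≫ t` in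
`T` is constant, then at every closed point `x` of `Γ` the residue field map `κ(p x) → κ(x)` is onto and
`𝔪_{p x} 𝒪_{Γ,x} = 𝔪_x` — the hypotheses of ★ `formallyUnramified_of_forall_isClosed_map_maximalIdeal`.
Residue fields: both are `ℂ` (Mathlib `residueFieldIsoBase`).  Ideals: `map_maximalIdeal_eq_of_tangent_rigid`
applied to `𝒪_{T,p x} → 𝒪_{Γ,x}`, a linear form `ℓ` on `𝔪_x/𝔪_x²` killing `𝔪_{p x}` being the `ℂ[ε]`-point
`Spec ℂ[ε] → Spec 𝒪_{Γ,x} → Γ` of `g_ℓ = ofDual ℓ`, whose image in `T` is the constant point at `p x`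
(`𝒪_{T,p x} = ℂ + 𝔪_{p x}`, `p x` closed), so that `g_ℓ` factors through `ℂ → ℂ[ε]` by hypothesis.
[cite: GortzWedhorn2020, (6.4) Prop. 6.7 and Exercise 3.18] [cite: StacksProject, Tag 02FM] -/
theorem stalk_of_dualNumber_rigid {Γ T : SchemeOver ℂ} (p : Γ ⟶ T)
    [LocallyOfFiniteType T.hom] [LocallyOfFiniteType p.left]
    (h : ∀ (γ : specOver ℂ ℂ[ε] ⟶ Γ) (t : 𝟙_ (SchemeOver ℂ) ⟶ T), γ ≫ p = toUnit _ ≫ t →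
      ∃ γ₀ : 𝟙_ (SchemeOver ℂ) ⟶ Γ, γ = toUnit _ ≫ γ₀)
    (x : Γ.left) (hx : IsClosed ({x} : Set Γ.left)) :
    Function.Surjective (IsLocalRing.ResidueField.map (p.left.stalkMap x).hom) ∧
      (IsLocalRing.maximalIdeal (T.left.presheaf.stalk (p.left.base x))).map (p.left.stalkMap x).hom =
        IsLocalRing.maximalIdeal (Γ.left.presheaf.stalk x) := by
  have hΓ : Γ.hom = p.left ≫ T.hom := (Over.w p).symm
  haveI : LocallyOfFiniteType Γ.hom := by rw [hΓ]; infer_instance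
  haveI : IsLocallyNoetherian Γ.left := LocallyOfFiniteType.isLocallyNoetherian Γ.hom
  -- `p x` is a closed point of `T` (it underlies the `ℂ`-point `Spec ℂ → Γ → T`)
  have hyc : IsClosed ({p.left.base x} : Set T.left) := by
    have hq : (pointOfClosedPoint Γ.hom x hx ≫ p.left) ≫ T.hom = 𝟙 _ := by
      rw [Category.assoc, ← hΓ, pointOfClosedPoint_comp]
    have := (pointEquivClosedPoint T.hom ⟨pointOfClosedPoint Γ.hom x hx ≫ p.left, hq⟩).2
    simpa only [pointEquivClosedPoint_apply_coe, Scheme.Hom.comp_apply, pointOfClosedPoint_apply,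
      mem_closedPoints_iff] using this
  refine ⟨?_, ?_⟩
  · -- residue fields: `ℂ = κ(p x) → κ(x) = ℂ` (adapted from `Motives.surjective_residueFieldMap_of_isClosed`)
    let e := residueFieldIsoBase Γ.hom x hx
    set pre' := Spec.preimage (T.left.fromSpecResidueField (p.left.base x) ≫ T.hom) with hpre'
    have h2 : Spec.map (pre' ≫ p.left.residueFieldMap x) = Spec.map e.inv := by
      rw [Spec.map_comp, hpre', Spec.map_preimage, SpecMap_residueFieldIsoBase_inv]
      conv_rhs => rw [hΓ]
      rw [Scheme.Hom.SpecMap_residueFieldMap_fromSpecResidueField_assoc]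
    have h3 : pre' ≫ p.left.residueFieldMap x = e.inv := Spec.map_injective h2
    have hbij : Function.Bijective (pre' ≫ p.left.residueFieldMap x).hom := by
      rw [h3]; exact ConcreteCategory.bijective_of_isIso e.inv
    rw [CommRingCat.hom_comp, RingHom.coe_comp] at hbij
    exact Function.Surjective.of_comp hbij.2
  · -- maximal ideals
    -- the structure maps `ℂ → 𝒪_{Γ,x}`, `ℂ → 𝒪_{T,p x}` and the augmentations (tactic-level abbreviations)
    set sΓ : CommRingCat.of ℂ ⟶ Γ.left.presheaf.stalk x :=
      ((Scheme.ΓSpecIso (.of ℂ)).inv ≫ (Spec (.of ℂ)).presheaf.germ ⊤ (Γ.hom.base x) trivial) ≫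
        Γ.hom.stalkMap x with hsΓ
    set sT : CommRingCat.of ℂ ⟶ T.left.presheaf.stalk (p.left.base x) :=
      ((Scheme.ΓSpecIso (.of ℂ)).inv ≫ (Spec (.of ℂ)).presheaf.germ ⊤ (T.hom.base (p.left.base x)) trivial) ≫
        T.hom.stalkMap (p.left.base x) with hsT
    set augΓ : Γ.left.presheaf.stalk x ⟶ CommRingCat.of ℂ :=
      Γ.left.residue x ≫ (residueFieldIsoBase Γ.hom x hx).hom with haugΓ
    set augT : T.left.presheaf.stalk (p.left.base x) ⟶ CommRingCat.of ℂ :=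
      T.left.residue (p.left.base x) ≫ (residueFieldIsoBase T.hom (p.left.base x) hyc).hom with haugT
    -- the `ℂ`-algebra structure of `B := 𝒪_{Γ,x}` and its augmentation
    letI algB : Algebra ℂ (Γ.left.presheaf.stalk x) := sΓ.hom.toAlgebra
    have hsφ : sT ≫ p.left.stalkMap x = sΓ := by
      rw [hsT, hsΓ, hΓ]
      exact (strMap_comp p.left T.hom x).symm
    let πB : Γ.left.presheaf.stalk x →ₐ[ℂ] ℂ :=
      { augΓ.hom with commutes' := fun c => augAt_strMap Γ.hom x hx c }
    have hπB : ∀ b, πB b = augΓ b := fun b => rfl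
    have hfg : (maximalIdeal (Γ.left.presheaf.stalk x)).FG := IsNoetherian.noetherian _
    refine map_maximalIdeal_eq_of_tangent_rigid πB (p.left.stalkMap x).hom hfg ?_
    intro g hg b hb
    -- the `ℂ[ε]`-point of `Γ` through `x` defined by the tangent vector `g`
    set gR : Γ.left.presheaf.stalk x ⟶ CommRingCat.of ℂ[ε] := CommRingCat.ofHom g.1.toRingHom
      with hgRdef
    have hgR : ∀ b, gR b = g.1 b := fun b => rfl
    haveI : IsLocalHom gR.hom := ⟨fun b hb' => by
      rw [hgR, isUnit_iff_isUnit_fst, g.2 b] at hb'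
      by_contra hnu
      exact hb'.ne_zero (by rw [hπB]; exact augAt_eq_zero_of_mem Γ.hom x hx hnu)⟩
    haveI : IsLocalHom (CommRingCat.ofHom (algebraMap ℂ ℂ[ε])).hom := isLocalHom_algebraMap_dualNumber
    obtain ⟨γ, hγ⟩ : ∃ γ : specOver ℂ ℂ[ε] ⟶ Γ, γ.left = (Spec.map gR ≫ Γ.left.fromSpecStalk x) :=
      ⟨Over.homMk ((Spec.map gR ≫ Γ.left.fromSpecStalk x)) (by
        change (Spec.map gR ≫ Γ.left.fromSpecStalk x) ≫ Γ.hom =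
          Spec.map (CommRingCat.ofHom (algebraMap ℂ ℂ[ε]))
        rw [Category.assoc, ← Spec_map_strMap, ← Spec.map_comp]
        congr 1
        apply CommRingCat.hom_ext
        refine RingHom.ext fun c => ?_
        rw [hgRdef]
        change g.1 (algebraMap ℂ _ c) = algebraMap ℂ ℂ[ε] c
        exact g.1.commutes c), rfl⟩
    -- the constant `ℂ`-point of `T` at `p x`
    obtain ⟨t, ht⟩ : ∃ t : 𝟙_ (SchemeOver ℂ) ⟶ T,
        t.left = (Spec.map augT ≫ T.left.fromSpecStalk (p.left.base x)) :=
      ⟨Over.homMk ((Spec.map augT ≫ T.left.fromSpecStalk (p.left.base x))) (by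
        change (Spec.map augT ≫ T.left.fromSpecStalk (p.left.base x)) ≫
          T.hom = 𝟙 _
        rw [Category.assoc, ← Spec_map_strMap, ← Spec.map_comp, haugT, strMap_comp_augAt, Spec.map_id]),
        rfl⟩
    -- `p ∘ γ` is that constant point: on rings `g ∘ p^♯ = (ℂ → ℂ[ε]) ∘ aug`, as `𝒪_{T,p x} = ℂ + 𝔪`
    have hsφ' : ∀ c, (p.left.stalkMap x).hom ((sT).hom c) =
        sΓ.hom c := fun c => by
      rw [← RingHom.comp_apply, ← CommRingCat.hom_comp, hsφ]
    have hring : p.left.stalkMap x ≫ gR =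
        augT ≫ CommRingCat.ofHom (algebraMap ℂ ℂ[ε]) := by
      apply CommRingCat.hom_ext
      refine RingHom.ext fun a => ?_
      rw [hgRdef]
      change g.1 ((p.left.stalkMap x).hom a) =
        algebraMap ℂ ℂ[ε] (augT.hom a)
      have ha' := sub_strMap_augAt_mem T.hom (p.left.base x) hyc a
      set a' := a - sT (augT a) with ha'def
      have hφa' : (p.left.stalkMap x).hom a' ∈ maximalIdeal _ :=
        IsLocalRing.map_maximalIdeal_le (p.left.stalkMap x).hom (Ideal.mem_map_of_mem _ ha')
      have hga' : g.1 ((p.left.stalkMap x).hom a') = 0 := by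
        refine TrivSqZeroExt.ext ?_ ?_
        · rw [g.2, hπB, fst_zero]
          exact augAt_eq_zero_of_mem Γ.hom x hx hφa'
        · rw [snd_zero]
          exact hg a' ha'
      have hadec : a = (sT).hom (augT.hom a) + a' := by
        rw [ha'def]; exact (add_sub_cancel _ _).symm
      have hφa : (p.left.stalkMap x).hom a =
          sΓ.hom (augT.hom a) + (p.left.stalkMap x).hom a' := by
        conv_lhs => rw [hadec]
        rw [map_add, hsφ']
      rw [hφa, map_add, hga', add_zero]
      exact g.1.commutes _
    have hγp : γ ≫ p = toUnit _ ≫ t := by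
      apply Over.OverMorphism.ext
      rw [Over.comp_left, Over.comp_left, Over.toUnit_left, hγ, ht]
      change (Spec.map gR ≫ Γ.left.fromSpecStalk x) ≫ p.left =
        Spec.map (CommRingCat.ofHom (algebraMap ℂ ℂ[ε])) ≫
          Spec.map augT ≫ T.left.fromSpecStalk (p.left.base x)
      rw [Category.assoc, ← Scheme.SpecMap_stalkMap_fromSpecStalk, ← Spec.map_comp_assoc, hring,
        Spec.map_comp_assoc]
    -- the hypothesis: `γ` is constant
    obtain ⟨γ₀, hγ₀⟩ := h γ t hγp
    have hleft : (Spec.map gR ≫ Γ.left.fromSpecStalk x) = Spec.map (CommRingCat.ofHom (algebraMap ℂ ℂ[ε])) ≫ γ₀.left := by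
      rw [← hγ, hγ₀, Over.comp_left, Over.toUnit_left]
      rfl
    have hx1 : ((Spec.map gR ≫ Γ.left.fromSpecStalk x)).base (closedPoint _) = x := specPtAt_closedPoint gR
    have hx0 : γ₀.left.base (closedPoint ℂ) = x := by
      have hx1' := hx1
      rw [hleft, Scheme.Hom.comp_apply, Spec_closedPoint] at hx1'
      exact hx1'
    have key : gR = ((Γ.left.presheaf.stalkCongr (.of_eq hx0)).inv ≫ Scheme.stalkClosedPointTo γ₀.left) ≫ CommRingCat.ofHom (algebraMap ℂ ℂ[ε]) := by
      rw [← locHomAt_specPtAt gR hx1, locHomAt_congr hleft hx1 (hleft ▸ hx1),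
        locHomAt_SpecMap_comp _ _ hx0 (hleft ▸ hx1)]
    -- so `g` factors through `ℂ → ℂ[ε]` and its `ε`-part vanishes
    have key' : g.1.toRingHom = (algebraMap ℂ ℂ[ε]).comp (((Γ.left.presheaf.stalkCongr (.of_eq hx0)).inv ≫ Scheme.stalkClosedPointTo γ₀.left)).hom := by
      have hk := congrArg CommRingCat.Hom.hom key
      rw [hgRdef, CommRingCat.hom_comp] at hk
      exact hk
    have hb' := RingHom.congr_fun key' b
    rw [RingHom.comp_apply, algebraMap_eq_inl] at hb'
    change (g.1.toRingHom b).snd = 0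
    rw [hb', snd_inl]

end DualNumberRigid

end Literature.AlgebraicGeometry.Morphisms
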